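import Summits.BirchSwinnertonDyer.BirchSwinnertonDyer.Theorems.KolyvaginRoadThreeSchneiderTamAtThreeHeightLogNumeratorDeepRefinedLaws
import Summits.BirchSwinnertonDyer.BirchSwinnertonDyer.Theorems.KolyvaginRoadThreeSchneiderTamAtThreeHeightLogNumeratorDeepCriterion
import HarnessLib

/-!
# Crux `SchneiderTamAtThree` (item 19154) — THE HEIGHT IS THE LOGARITHM OF THE NUMERATOR, DEEP POINTS,
# part 7: the REFINED deep numerator criterion and its one-congruence certificate checker (`d ≤ min(2k, ν+1)`)

HONEST FRAMING (cell `bsd-stepL`, seat `bsd-stepL-tam3-p2` g2, WIDTH-LEVER second lane «closed-form Schneider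
local factor at 3 … finite case table proved once»; `--supports stmt-BirchSwinnertonDyer-19154 --as helper`):
THEOREMS ONLY, route-free (no Theses import); 0 definitions, 0 named facts, 0 sorry; every rung is about ONE
curve and is modulo GZK (rank one, by name); Schneider's conjecture is asserted nowhere; nothing class-wide
is proved; BSD is not claimed.

* `heightFourOneCoord_ne_zero_of_num_criterion_deep'` / `…_of_not_pow_dvd_deep'` — part 4 with the refined
  law (part 6): **`3^{v₃(den x) + d} ∤ c₄(a³ − a) + 2(b₂b₄ − 18b₆)·den x ⟹ ĥ₃(P) ≠ 0`** for a point of level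
  `≥ 2`, any `d ≤ v₃(den x)` with `3⁻¹‖q‖ ≤ 3^{−d}` (for THE Tate parameter: `d ≤ v₃Δ + 1`).
* `regulatorNonvanishingAt_three_of_num_criterion_deep'`, `rung_of_numCriterion_deep'`, `rungTam_…'` — rank
  one and the generic checker in lane A's REG3CERT row format with the side condition `3^d ∣ 3Δ`. With the
  rows of part 8 this checker family decides EVERY row of lane A's table of record (kit j285773: 683 by
  part 4's `d ≤ ν`, the remaining 7 here at `3Q` with `d = ν + 1`).

References: [SteinWuthrich2013] §4.2, Conj. 4.1; [Schneider1982PadicHeightI] §1; [KolyvaginEulerSystems1990]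
Thm. A; [SilvermanAEC2009] III.1, VII.2; tree: deep parts 4, 6b, lane A `ClassRecordThreeRegCertKernel{,O2Cert}`.
-/

noncomputable section

open scoped Classical Nat
open Filter Topology IsUltrametricDist PowerSeries
open WeierstrassCurve Literature.NumberTheory.EllipticCurves
open Literature.NumberTheory.EllipticCurves.SteinWuthrich2013
open Literature.NumberTheory.EllipticCurves.TateCurve
open Literature.NumberTheory.EllipticCurves.Rank1Residual
open Summit.BirchSwinnertonDyer.Uniform.UI.O2
open Summit.BirchSwinnertonDyer.Rank1Residual Summit.BirchSwinnertonDyer.Rank1Residual.X11b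

namespace Summit.BirchSwinnertonDyer.Rank1Residual.X11b.RegMult.HeightLogNumerator

/-! ### §15 The refined criterion -/

section Criterion

variable {W : WeierstrassCurve ℚ}

/-- **THE REFINED DEEP NUMERATOR CRITERION** (part 4's criterion with `3⁻¹‖q‖` in place of `‖q‖`): for a
rational point of level `≥ 2`, `‖c₄a(a² − 1) + 2(b₂b₄ − 18b₆)D‖₃ > ‖x‖₃⁻¹·max(‖x‖₃⁻¹, 3⁻¹‖q‖₃) ⟹ ĥ₃(P) ≠ 0`.
[cite: SteinWuthrich2013, §4.2, Conj. 4.1] [cite: Schneider1982PadicHeightI, §1] -/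
theorem heightFourOneCoord_ne_zero_of_num_criterion_deep' [W.IsElliptic] [W.IsGloballyMinimal]
    (hW : Mult W 3) {q : ℚ_[3]} (hq : ‖q‖ < 1) {x y : ℚ} (hxy : W.toAffine.Nonsingular x y)
    (hx : 1 < ‖(x : ℚ_[3])‖) (hz9 : ‖-(x : ℚ_[3]) / y‖ ≤ 1 / 9)
    (hcrit : ‖(x : ℚ_[3])‖⁻¹ * max ‖(x : ℚ_[3])‖⁻¹ (3⁻¹ * ‖q‖) <
      ‖(W.baseChange ℚ_[3]).c₄ * ((x.num : ℚ) : ℚ_[3]) * (((x.num : ℚ) : ℚ_[3]) ^ 2 - 1) +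
          2 * ((W.baseChange ℚ_[3]).b₂ * (W.baseChange ℚ_[3]).b₄ - 18 * (W.baseChange ℚ_[3]).b₆) *
            ((x.den : ℚ) : ℚ_[3])‖) :
    heightFourOneCoord W 3 q x y ≠ 0 := by
  set X : ℚ_[3] := (x : ℚ_[3]) with hXdef
  set V := W.baseChange ℚ_[3] with hVdef
  set a : ℚ_[3] := ((x.num : ℚ) : ℚ_[3]) with hadef
  set D : ℚ_[3] := ((x.den : ℚ) : ℚ_[3]) with hDdef
  set ε : ℝ := ‖X‖⁻¹ * max ‖X‖⁻¹ (3⁻¹ * ‖q‖) with hεdef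
  set κ' : ℚ_[3] := (V.b₂ * V.b₄ - 18 * V.b₆) / V.c₄ with hκ'def
  have hX0n : 0 < ‖X‖ := one_pos.trans hx
  have hXi1 : ‖X‖⁻¹ ≤ 1 := inv_le_one_of_one_le₀ hx.le
  have hnum : a = X * D := by rw [hadef, hXdef, hDdef, ← Rat.cast_mul, Rat.mul_den_eq_num]
  have hDn : ‖D‖ = ‖X‖⁻¹ := by rw [hDdef]; exact norm_den_eq_inv_norm hx
  have han : ‖a‖ = 1 := by rw [hnum, norm_mul, hDn, mul_inv_cancel₀ hX0n.ne']
  have ha0 : a ≠ 0 := norm_pos_iff.mp (by rw [han]; exact one_pos)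
  have hd0 : D ≠ 0 := by rw [hDdef]; exact_mod_cast x.den_nz
  obtain ⟨hc4, -⟩ := norm_c₄_c₆_baseChange_eq_one (W := W) hW
  have hc40 : V.c₄ ≠ 0 := norm_pos_iff.mp (by rw [hc4]; exact one_pos)
  have h2n : ‖(2 : ℚ_[3])‖ = 1 := by
    simpa using Padic.norm_natCast_eq_one_iff.mpr (show Nat.Coprime 3 2 by decide)
  have hmax1 : max ‖X‖⁻¹ (3⁻¹ * ‖q‖) ≤ 1 := max_le hXi1 (by nlinarith [hq.le, norm_nonneg q])
  have hεX : ε ≤ ‖X‖⁻¹ := by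
    calc ε = ‖X‖⁻¹ * max ‖X‖⁻¹ (3⁻¹ * ‖q‖) := rfl
      _ ≤ ‖X‖⁻¹ * 1 := by gcongr
      _ = ‖X‖⁻¹ := mul_one _
  have hXXε : ‖X‖⁻¹ * ‖X‖⁻¹ ≤ ε := by
    calc ‖X‖⁻¹ * ‖X‖⁻¹ ≤ ‖X‖⁻¹ * max ‖X‖⁻¹ (3⁻¹ * ‖q‖) := by gcongr; exact le_max_left _ _
      _ = ε := rfl
  -- `κ'` is a `3`-adic integer
  have hκ' : ‖κ'‖ ≤ 1 := by
    obtain ⟨hb2, hb4, hb6⟩ : ‖V.b₂‖ ≤ 1 ∧ ‖V.b₄‖ ≤ 1 ∧ ‖V.b₆‖ ≤ 1 := by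
      have h := V.eq_map_integralModel
      refine ⟨?_, ?_, ?_⟩
      · have e := congrArg WeierstrassCurve.b₂ h
        rw [map_b₂] at e; rw [← e]; exact PadicInt.norm_le_one _
      · have e := congrArg WeierstrassCurve.b₄ h
        rw [map_b₄] at e; rw [← e]; exact PadicInt.norm_le_one _
      · have e := congrArg WeierstrassCurve.b₆ h
        rw [map_b₆] at e; rw [← e]; exact PadicInt.norm_le_one _
    rw [hκ'def, norm_div, hc4, div_one]
    refine (norm_sub_le_max₃ _ _).trans (max_le ?_ ?_)
    · rw [norm_mul]
      calc ‖V.b₂‖ * ‖V.b₄‖ ≤ 1 * 1 := by gcongr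
        _ = 1 := one_mul _
    · rw [norm_mul]
      have h18 : ‖(18 : ℚ_[3])‖ ≤ 1 := by
        have h : ((18 : ℤ) : ℚ_[3]) = 18 := by norm_cast
        rw [← h]; exact Padic.norm_int_le_one 18
      calc ‖(18 : ℚ_[3])‖ * ‖V.b₆‖ ≤ 1 * 1 := by gcongr
        _ = 1 := one_mul _
  -- the deep-point law
  have hR := norm_heightFourOneCoord_sub_padicLog_num_sub_le_deep' hW hq hxy hx hz9
  intro hH
  rw [hH, zero_sub] at hR
  have hloga : ‖padicLog 3 a‖ = ‖a ^ 2 - 1‖ := by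
    rw [SchneiderClosedFormOddPrime.norm_padicLog_of_norm_eq_one (p := 3) (by norm_num) han,
      show (3 - 1 : ℕ) = 2 from rfl, norm_sub_rev]
  rcases lt_or_ge ‖X‖⁻¹ ‖a ^ 2 - 1‖ with h1 | h1
  · -- first order decides: `‖log a‖ ≤ ‖X‖⁻¹ < ‖a² − 1‖ = ‖log a‖`
    have hκD : ‖κ' * (D / a)‖ ≤ ‖X‖⁻¹ := by
      rw [norm_mul, norm_div D a, han, div_one, hDn]
      calc ‖κ'‖ * ‖X‖⁻¹ ≤ 1 * ‖X‖⁻¹ := by gcongr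
        _ = ‖X‖⁻¹ := one_mul _
    have hlog : ‖padicLog 3 a‖ ≤ ‖X‖⁻¹ := by
      have e : padicLog 3 a = -(-padicLog 3 a - κ' * (D / a)) - κ' * (D / a) := by ring
      rw [e]
      refine (norm_sub_le_max₃ _ _).trans (max_le ?_ hκD)
      rw [norm_neg]
      exact hR.trans hεX
    rw [hloga] at hlog
    exact absurd h1 (not_lt.mpr hlog)
  · -- first order silent: `‖2ac₄·0 − N‖ ≤ max(ε, ‖a² − 1‖²) = ε < ‖N‖`
    set G : ℚ_[3] := padicLog 3 a - (a ^ 2 - 1) / 2 with hGdef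
    have hG : ‖G‖ ≤ ‖a ^ 2 - 1‖ ^ 2 := by
      have h := norm_padicLog_sub_div_le (p := 3) (by norm_num) han
      rw [show (3 - 1 : ℕ) = 2 from rfl, show ((3 : ℕ) : ℚ_[3]) - 1 = 2 by norm_num] at h
      exact h
    have e : V.c₄ * a * (a ^ 2 - 1) + 2 * (V.b₂ * V.b₄ - 18 * V.b₆) * D =
        -(2 * a * V.c₄ * ((-padicLog 3 a - κ' * (D / a)) + G)) := by
      rw [hGdef, hκ'def]
      field_simp
      ring
    have hle : ‖V.c₄ * a * (a ^ 2 - 1) + 2 * (V.b₂ * V.b₄ - 18 * V.b₆) * D‖ ≤ ε := by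
      rw [e, norm_neg, norm_mul, norm_mul, norm_mul, h2n, han, hc4, one_mul, one_mul, one_mul]
      refine (norm_add_le_max _ _).trans (max_le hR (hG.trans ?_))
      calc ‖a ^ 2 - 1‖ ^ 2 ≤ ‖X‖⁻¹ ^ 2 := by gcongr
        _ = ‖X‖⁻¹ * ‖X‖⁻¹ := sq _
        _ ≤ ε := hXXε
    exact absurd hcrit (not_lt.mpr hle)

/-- **The refined deep criterion in integers.** If `c₄(a³ − a) + 2(b₂b₄ − 18b₆)·den x = N ∈ ℤ` (`a = num x`;
`b₂, b₄, b₆, c₄` the integers of the minimal model), the level is `≥ 2` (`3⁴ ∣ den x`), `d ≤ v₃(den x)`,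
`3⁻¹‖q‖₃ ≤ 3^{−d}` and **`3^{v₃(den x) + d} ∤ N`**, then `ĥ₃(P) ≠ 0` (the gain over part 4 is
`d = min(2k, v₃Δ + 1)` for the Tate parameter). [cite: SteinWuthrich2013, §4.2, Conj. 4.1] -/
theorem heightFourOneCoord_ne_zero_of_not_pow_dvd_deep' [W.IsElliptic] [W.IsGloballyMinimal]
    (hW : Mult W 3) {q : ℚ_[3]} (hq : ‖q‖ < 1) {x y : ℚ} (hxy : W.toAffine.Nonsingular x y)
    (hx : 1 < ‖(x : ℚ_[3])‖) (h4 : 4 ≤ padicValNat 3 x.den) {d : ℕ} (hd : d ≤ padicValNat 3 x.den)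
    (hqd : 3⁻¹ * ‖q‖ ≤ (3 : ℝ) ^ (-(d : ℤ))) {N : ℤ}
    (hN : W.c₄ * ((x.num : ℚ) ^ 3 - x.num) + 2 * (W.b₂ * W.b₄ - 18 * W.b₆) * (x.den : ℚ) = (N : ℚ))
    (h : ¬ ((3 : ℤ) ^ (padicValNat 3 x.den + d) ∣ N)) :
    heightFourOneCoord W 3 q x y ≠ 0 := by
  have hden : ‖(x : ℚ_[3])‖⁻¹ = (3 : ℝ) ^ (-(padicValNat 3 x.den : ℤ)) := by
    rw [← norm_den_eq_inv_norm hx, Rat.cast_natCast,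
      Padic.norm_eq_zpow_neg_valuation (by exact_mod_cast x.den_nz), Padic.valuation_natCast]
    norm_cast
  -- level `≥ 2`: `‖z‖² = ‖x‖⁻¹ ≤ 3⁻⁴`
  have hz9 : ‖-(x : ℚ_[3]) / y‖ ≤ 1 / 9 := by
    obtain ⟨-, hz2⟩ := norm_neg_div_of_one_lt_norm (p := 3) hxy hx
    have hsq : ‖-(x : ℚ_[3]) / y‖ ^ 2 ≤ (1 / 9) ^ 2 := by
      rw [hz2, hden]
      calc (3 : ℝ) ^ (-(padicValNat 3 x.den : ℤ)) ≤ (3 : ℝ) ^ (-(4 : ℤ)) := by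
            apply zpow_le_zpow_right₀ (by norm_num); omega
        _ = (1 / 9) ^ 2 := by norm_num
    exact (pow_le_pow_iff_left₀ (norm_nonneg _) (by norm_num) two_ne_zero).mp hsq
  refine heightFourOneCoord_ne_zero_of_num_criterion_deep' hW hq hxy hx hz9 ?_
  have hc4 : (W.baseChange ℚ_[3]).c₄ = ((W.c₄ : ℚ) : ℚ_[3]) :=
    (map_c₄ W (algebraMap ℚ ℚ_[3])).trans (eq_ratCast _ _)
  have hb2 : (W.baseChange ℚ_[3]).b₂ = ((W.b₂ : ℚ) : ℚ_[3]) :=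
    (map_b₂ W (algebraMap ℚ ℚ_[3])).trans (eq_ratCast _ _)
  have hb4 : (W.baseChange ℚ_[3]).b₄ = ((W.b₄ : ℚ) : ℚ_[3]) :=
    (map_b₄ W (algebraMap ℚ ℚ_[3])).trans (eq_ratCast _ _)
  have hb6 : (W.baseChange ℚ_[3]).b₆ = ((W.b₆ : ℚ) : ℚ_[3]) :=
    (map_b₆ W (algebraMap ℚ ℚ_[3])).trans (eq_ratCast _ _)
  have hcast : (W.baseChange ℚ_[3]).c₄ * ((x.num : ℚ) : ℚ_[3]) * (((x.num : ℚ) : ℚ_[3]) ^ 2 - 1) +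
      2 * ((W.baseChange ℚ_[3]).b₂ * (W.baseChange ℚ_[3]).b₄ - 18 * (W.baseChange ℚ_[3]).b₆) *
        ((x.den : ℚ) : ℚ_[3]) = ((N : ℚ) : ℚ_[3]) := by
    rw [hc4, hb2, hb4, hb6, ← hN]
    push_cast
    ring
  rw [hcast, hden, Rat.cast_intCast]
  -- `ε ≤ 3^{−(v + d)} < ‖N‖`
  have hε : (3 : ℝ) ^ (-(padicValNat 3 x.den : ℤ)) * max ((3 : ℝ) ^ (-(padicValNat 3 x.den : ℤ))) (3⁻¹ * ‖q‖) ≤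
      (3 : ℝ) ^ (-((padicValNat 3 x.den + d : ℕ) : ℤ)) := by
    have hm : max ((3 : ℝ) ^ (-(padicValNat 3 x.den : ℤ))) (3⁻¹ * ‖q‖) ≤ (3 : ℝ) ^ (-(d : ℤ)) :=
      max_le (zpow_le_zpow_right₀ (by norm_num) (by omega)) hqd
    calc (3 : ℝ) ^ (-(padicValNat 3 x.den : ℤ)) * max ((3 : ℝ) ^ (-(padicValNat 3 x.den : ℤ))) (3⁻¹ * ‖q‖)
        ≤ (3 : ℝ) ^ (-(padicValNat 3 x.den : ℤ)) * (3 : ℝ) ^ (-(d : ℤ)) := by gcongr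
      _ = (3 : ℝ) ^ (-((padicValNat 3 x.den + d : ℕ) : ℤ)) := by
        rw [← zpow_add₀ (by norm_num : (3 : ℝ) ≠ 0)]; congr 1; push_cast; ring
  refine lt_of_le_of_lt hε ?_
  by_contra hle
  exact h ((Padic.norm_int_le_pow_iff_dvd _ _).mp (by exact_mod_cast not_lt.mp hle))

end Criterion

/-! ### §10 Rank one, the generic checker and a row of record -/

section RankOne

variable {W : WeierstrassCurve ℚ}

/-- **Schneider's binder at `3` from ONE rational point of level `≥ 2`, by integer arithmetic (refined
deep).** For `W/ℚ` globally minimal, NON-split multiplicative at `3`, of Mordell–Weil rank one, with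
`3⁻¹‖1/j‖₃ ≤ 3^{−d}` (`3^d ∣ 3Δ`, `3 ∤ c₄`): if some ADMISSIBLE rational point `P = (x, y)` with `3⁴ ∣ den x`, `d ≤ v₃(den x)`
satisfies `3^{v₃(den x)+d} ∤ c₄((num x)³ − num x) + 2(b₂b₄ − 18b₆)·den x`, then
`ClassClosure.RegulatorNonvanishingAt W 3`: for THE Tate parameter `‖q‖₃ = ‖j‖₃⁻¹`
(`norm_tateJ_eq`), `ĥ₃(P) ≠ 0` by the refined deep criterion, and one anisotropic point gives `Reg₃ ≠ 0` in rank
one. [cite: SteinWuthrich2013, §4.2, Conj. 4.1] [cite: Schneider1982PadicHeightI, §1] -/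
theorem regulatorNonvanishingAt_three_of_num_criterion_deep' [W.IsElliptic] [W.IsGloballyMinimal]
    (hW : Mult W 3) (hns : ¬ W.HasSplitMultiplicativeReductionAtPrime 3) (hr : W.mordellWeilRank = 1)
    {x y : ℚ} {h : W.toAffine.Nonsingular x y} (hadm : W.IsAdmissible 3 (.some x y h))
    (h4 : 4 ≤ padicValNat 3 x.den) {d : ℕ} (hd : d ≤ padicValNat 3 x.den)
    (hjd : 3⁻¹ * ‖((W.j : ℚ_[3]))⁻¹‖ ≤ (3 : ℝ) ^ (-(d : ℤ))) {N : ℤ}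
    (hN : W.c₄ * ((x.num : ℚ) ^ 3 - x.num) + 2 * (W.b₂ * W.b₄ - 18 * W.b₆) * (x.den : ℚ) = (N : ℚ))
    (hcrit : ¬ ((3 : ℤ) ^ (padicValNat 3 x.den + d) ∣ N)) :
    X11b.ClassClosure.RegulatorNonvanishingAt W 3 := by
  refine ⟨fun q Dh _ hq1 hj hDh => ?_, fun Dq _ _ => absurd Dq.split hns⟩
  refine X11b.schneider_of_isMultCanonical_of_heightFourOne_ne_zero hr hDh hadm ?_
  rw [heightFourOne_some]
  have hqd : 3⁻¹ * ‖q‖ ≤ (3 : ℝ) ^ (-(d : ℤ)) := by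
    have e : ‖q‖ = ‖((W.j : ℚ_[3]))⁻¹‖ := by rw [norm_inv, ← hj, norm_tateJ_eq hq1, inv_inv]
    rw [e]; exact hjd
  exact heightFourOneCoord_ne_zero_of_not_pow_dvd_deep' hW hq1 h hadm.2.1 h4 hd hqd hN hcrit

/-- **Generic REFINED DEEP REG3CERT checker, class-record shape** (crux `SchneiderAtThree`, item 19106): for the
integer model `W = ⟨a₁,…,a₆⟩`, the point `Q = (a/e², b/e³)` with `e = 3ᵏe'`, `2 ≤ k`, `3 ∤ e'`,
`gcd(a, e) = 1`, the gcd test (non-singular reduction everywhere), `c₄` and `Δ` by the integer formulas,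
`3 ∤ c₄`, `3^d ∣ 3Δ`, `d ≤ 2k`, and **`3^{2k+d} ∤ N`, `N = c₄(a³ − a) + 2(b₂b₄ − 18b₆)e²`**, the rung
`ClassX11b W 3 → Ram W 3 → ¬split(3) → RegulatorNonvanishingAt W 3` holds modulo GZK. ONE curve per
application; every hypothesis is decided by `norm_num`/`decide`. [cite: SteinWuthrich2013, §4.2 and Conj. 4.1]
[cite: SilvermanAEC2009, III.1, VII.2.1] [cite: KolyvaginEulerSystems1990, Thm. A] -/
theorem rung_of_numCriterion_deep' (hGZK : rank_eq_analyticRank_of_analyticRank_le_one)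
    (W : WeierstrassCurve ℚ) {a₁ a₂ a₃ a₄ a₆ : ℤ} (hW : W = ⟨a₁, a₂, a₃, a₄, a₆⟩) [W.IsElliptic]
    [W.IsGloballyMinimal] {a b N c4 Dsc : ℤ} {e' k n d : ℕ}
    (H : ¬ 3 ∣ e' ∧ 2 ≤ k ∧ Nat.Coprime a.natAbs (3 ^ k * e') ∧
      Int.gcd (2 * b + a₁ * a * (3 ^ k * e' : ℕ) + a₃ * (3 ^ k * e' : ℕ) ^ 3)
        (a₁ * b * (3 ^ k * e' : ℕ) - (3 * a ^ 2 + 2 * a₂ * a * (3 ^ k * e' : ℕ) ^ 2 + a₄ * (3 ^ k * e' : ℕ) ^ 4))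
        ∣ (3 ^ k * e') ^ n ∧
      c4 = (a₁ ^ 2 + 4 * a₂) ^ 2 - 24 * (2 * a₄ + a₁ * a₃) ∧
      Dsc = -(a₁ ^ 2 + 4 * a₂) ^ 2 * (a₁ ^ 2 * a₆ + 4 * a₂ * a₆ - a₁ * a₃ * a₄ + a₂ * a₃ ^ 2 - a₄ ^ 2) -
        8 * (2 * a₄ + a₁ * a₃) ^ 3 - 27 * (a₃ ^ 2 + 4 * a₆) ^ 2 +
        9 * (a₁ ^ 2 + 4 * a₂) * (2 * a₄ + a₁ * a₃) * (a₃ ^ 2 + 4 * a₆) ∧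
      ¬ (3 : ℤ) ∣ c4 ∧ (3 : ℤ) ^ d ∣ 3 * Dsc ∧ d ≤ 2 * k ∧
      c4 * (a ^ 3 - a) + 2 * ((a₁ ^ 2 + 4 * a₂) * (2 * a₄ + a₁ * a₃) - 18 * (a₃ ^ 2 + 4 * a₆)) *
        ((3 ^ k * e' : ℕ) : ℤ) ^ 2 = N ∧
      ¬ (3 : ℤ) ^ (2 * k + d) ∣ N)
    {x y : ℚ} (hx : x = a / ((3 ^ k * e' : ℕ) : ℚ) ^ 2) (hy : y = b / ((3 ^ k * e' : ℕ) : ℚ) ^ 3)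
    (hP : W.toAffine.Equation x y) :
    ClassX11b W 3 → Ram W 3 → ¬ W.HasSplitMultiplicativeReductionAtPrime 3 →
      ClassClosure.RegulatorNonvanishingAt W 3 := by
  intro hX _ hns
  obtain ⟨h3e', hk, hcop, hgcd, hc4, hD, h3c4, h3D, hdk, hN, hcrit⟩ := H
  haveI : Fact (Nat.Prime 3) := ⟨Nat.prime_three⟩
  have he'0 : e' ≠ 0 := by rintro rfl; exact h3e' (dvd_zero 3)
  have he0 : (3 ^ k * e' : ℕ) ≠ 0 := by positivity
  have h3e : 3 ∣ 3 ^ k * e' := dvd_mul_of_dvd_left (dvd_pow_self 3 (by omega)) _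
  have h : W.toAffine.Nonsingular x y :=
    (WeierstrassCurve.Affine.equation_iff_nonsingular (W := W.toAffine)).mp hP
  have hx1 : 1 < ‖(x : ℚ_[3])‖ :=
    (one_lt_norm_ratCast_iff 3 x).mpr (KernelCert.padicValRat_x_neg he0 hx hcop h3e)
  have hadm : W.IsAdmissible 3 (.some x y h) :=
    isAdmissible_of_one_lt_norm (by norm_num) h hx1
      (KernelCert.hasNonsingularReductionAt_of_gcd W hW he0 hx hy hcop hgcd)
  -- `num x = a`, `den x = e²`, `v₃(den x) = 2k`
  set e : ℕ := 3 ^ k * e' with hedef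
  have hcop2 : Nat.Coprime a.natAbs (((e : ℤ) ^ 2).natAbs) := by
    rw [Int.natAbs_pow, Int.natAbs_natCast]; exact hcop.pow_right 2
  have he2pos : (0 : ℤ) < (e : ℤ) ^ 2 := by positivity
  have hxq : x = ((a : ℤ) : ℚ) / (((e : ℤ) ^ 2 : ℤ) : ℚ) := by rw [hx]; push_cast; ring
  have hnum : x.num = a := by rw [hxq]; exact Rat.num_div_eq_of_coprime he2pos hcop2
  have hden : (x.den : ℤ) = (e : ℤ) ^ 2 := by rw [hxq]; exact Rat.den_div_eq_of_coprime he2pos hcop2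
  have hden' : x.den = e ^ 2 := by exact_mod_cast hden
  have hv : padicValNat 3 x.den = 2 * k := by
    rw [hden', hedef, padicValNat.pow (3 ^ k * e') 2, padicValNat.mul (pow_ne_zero _ (by norm_num)) he'0,
      padicValNat.prime_pow, padicValNat.eq_zero_of_not_dvd h3e']
    ring
  -- the integer identity
  have hN' : W.c₄ * ((x.num : ℚ) ^ 3 - x.num) + 2 * (W.b₂ * W.b₄ - 18 * W.b₆) * (x.den : ℚ) = (N : ℚ) := by
    rw [hnum, show (x.den : ℚ) = ((x.den : ℤ) : ℚ) by norm_cast, hden, ← hN, hc4]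
    subst hW
    simp only [WeierstrassCurve.c₄, WeierstrassCurve.b₂, WeierstrassCurve.b₄, WeierstrassCurve.b₆]
    push_cast
    ring
  -- `3⁻¹‖1/j‖₃ = ‖3Δ/c₄³‖₃ ≤ 3^{−d}`
  have hjd : 3⁻¹ * ‖((W.j : ℚ_[3]))⁻¹‖ ≤ (3 : ℝ) ^ (-(d : ℤ)) := by
    rw [KernelCert.ratCast_j_inv_eq W hW hc4 hD, norm_div, norm_pow]
    have hc4n : ‖(c4 : ℚ_[3])‖ = 1 := by
      have hle := Padic.norm_int_le_one (p := 3) c4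
      have hnlt : ¬ ‖(c4 : ℚ_[3])‖ < 1 := fun hlt =>
        h3c4 (by exact_mod_cast (Padic.norm_intCast_lt_one_iff (p := 3)).mp hlt)
      exact le_antisymm hle (not_lt.mp hnlt)
    have h3n : ‖(3 : ℚ_[3])‖ = 3⁻¹ := by
      rw [show (3 : ℚ_[3]) = ((3 : ℕ) : ℚ_[3]) by norm_cast, Padic.norm_p]; norm_num
    rw [hc4n, one_pow, div_one, ← h3n, ← norm_mul]
    have h3D' : ((3 : ℕ) : ℤ) ^ d ∣ 3 * Dsc := by exact_mod_cast h3D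
    have h := (Padic.norm_int_le_pow_iff_dvd (p := 3) (3 * Dsc) d).mpr h3D'
    simp only [Int.cast_mul, Int.cast_ofNat, Nat.cast_ofNat] at h
    exact h
  have h4 : 4 ≤ padicValNat 3 x.den := by rw [hv]; omega
  have hd' : d ≤ padicValNat 3 x.den := by rw [hv]; exact hdk
  have hcrit' : ¬ ((3 : ℤ) ^ (padicValNat 3 x.den + d) ∣ N) := by rwa [hv]
  exact regulatorNonvanishingAt_three_of_num_criterion_deep' hX.2.2.1 hns
    (mordellWeilRank_eq_one_of_analyticRank hGZK hX.1) hadm h4 hd' hjd hN' hcrit'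

/-- **Generic REFINED DEEP REG3CERT checker, Kolyvagin-road shape** (crux `SchneiderTamAtThree`, item 19154): the
same rung with the extra binder `3 ∣ ∏ c_ℓ`, not used. ONE curve per application.
[cite: SteinWuthrich2013, §4.2 and Conj. 4.1] [cite: KolyvaginEulerSystems1990, Thm. A] -/
theorem rungTam_of_numCriterion_deep' (hGZK : rank_eq_analyticRank_of_analyticRank_le_one)
    (W : WeierstrassCurve ℚ) {a₁ a₂ a₃ a₄ a₆ : ℤ} (hW : W = ⟨a₁, a₂, a₃, a₄, a₆⟩) [W.IsElliptic]
    [W.IsGloballyMinimal] {a b N c4 Dsc : ℤ} {e' k n d : ℕ}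
    (H : ¬ 3 ∣ e' ∧ 2 ≤ k ∧ Nat.Coprime a.natAbs (3 ^ k * e') ∧
      Int.gcd (2 * b + a₁ * a * (3 ^ k * e' : ℕ) + a₃ * (3 ^ k * e' : ℕ) ^ 3)
        (a₁ * b * (3 ^ k * e' : ℕ) - (3 * a ^ 2 + 2 * a₂ * a * (3 ^ k * e' : ℕ) ^ 2 + a₄ * (3 ^ k * e' : ℕ) ^ 4))
        ∣ (3 ^ k * e') ^ n ∧
      c4 = (a₁ ^ 2 + 4 * a₂) ^ 2 - 24 * (2 * a₄ + a₁ * a₃) ∧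
      Dsc = -(a₁ ^ 2 + 4 * a₂) ^ 2 * (a₁ ^ 2 * a₆ + 4 * a₂ * a₆ - a₁ * a₃ * a₄ + a₂ * a₃ ^ 2 - a₄ ^ 2) -
        8 * (2 * a₄ + a₁ * a₃) ^ 3 - 27 * (a₃ ^ 2 + 4 * a₆) ^ 2 +
        9 * (a₁ ^ 2 + 4 * a₂) * (2 * a₄ + a₁ * a₃) * (a₃ ^ 2 + 4 * a₆) ∧
      ¬ (3 : ℤ) ∣ c4 ∧ (3 : ℤ) ^ d ∣ 3 * Dsc ∧ d ≤ 2 * k ∧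
      c4 * (a ^ 3 - a) + 2 * ((a₁ ^ 2 + 4 * a₂) * (2 * a₄ + a₁ * a₃) - 18 * (a₃ ^ 2 + 4 * a₆)) *
        ((3 ^ k * e' : ℕ) : ℤ) ^ 2 = N ∧
      ¬ (3 : ℤ) ^ (2 * k + d) ∣ N)
    {x y : ℚ} (hx : x = a / ((3 ^ k * e' : ℕ) : ℚ) ^ 2) (hy : y = b / ((3 ^ k * e' : ℕ) : ℚ) ^ 3)
    (hP : W.toAffine.Equation x y) :
    ClassX11b W 3 → Ram W 3 → ¬ W.HasSplitMultiplicativeReductionAtPrime 3 → 3 ∣ W.tamagawaProduct →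
      ClassClosure.RegulatorNonvanishingAt W 3 :=
  fun hX hram hns _ => rung_of_numCriterion_deep' hGZK W hW H hx hy hP hX hram hns

end RankOne

end Summit.BirchSwinnertonDyer.Rank1Residual.X11b.RegMult.HeightLogNumerator

end
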